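/-
Copyright (c) 2026. All rights reserved.
Released under Apache 2.0 license as described in the file LICENSE.
Authors: HodgeCM publication cell (pub-hodgecm), GR lane, seat GR-2 (`pub-hodgecm-own-hyp34`).
-/
import Literature.NumberTheory.Weil1964.ArchUnitaryWeilHalf3
import HarnessLib

/-!
# The archimedean half `s_∞ : U(J)(F ⊗ ℝ) →* Mp_ψ(W_𝔸)ᶜᵒⁿᵗ` of the Weil splitting over a GENERAL quadratic `E/F`

Sequel of `ArchUnitaryWeilHalf3` (three-block section `archWeilSection3 x₂ x₃` and its frame dictionary); twin of
`ArchUnitaryWeilHalfGen` §3 (which needs `E` totally complex over the real places of `F`).  For ANY quadratic extension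
of number fields `E/F` (real places of `F` of both types (i) `E_v = ℂ` and (ii) `E_v = ℝ × ℝ`, and complex places),
`J = diag(t₀) ⊗ 1` non-degenerate:

* **`archWeilHalf3 x₂ hx₂ x₃ hx₃ : U(J)(F ⊗ ℝ) →* Mp_ψ(W_𝔸)ᶜᵒⁿᵗ`** := `archLift` (`AdelicMetaplecticArchSection`) of
  `archWeilSection3 x₂ x₃` in the frame `frame3` over `ι_𝔸 ∘ (g ↦ (g, 1))`, with `proj_archWeilHalf3` (`rfl`),
  `isArch_archWeilHalf3` (`ω(s_∞ g) = A_g ⊗ 1`), `omega_archWeilHalf3`, `continuous_archWeilHalf3`;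
* `exists_archWeilHalf3_lifts`: lifts `x₂` (framed split Cayley elements) and `x₃` (realified complex Cayley elements)
  exist (Folland's `π : Mp^𝓢 → Sp` is onto), hence so does `s_∞`.

These are the fields `continuous`, `proj_eq`, `isArch` of `GRConstructionGen.IsArchHalf` for a general `E/F`; the
`parabolic` field (type-(ii) places: the Siegel parabolic `P_Δ(F_v) ≅ GL_n(ℝ) ⋉ Sym_n(ℝ)` is not square-generated,
`quot_archWeilSection3` carries the sign characters `sgn det g_{w₂(v)}`) is the sequel.  Topic `NumberTheory/Weil1964`;
KERNEL ONLY.  Written for the stage-1 cell `pub-hodgecm` (GR lane); nothing here is a claim of the manuscripts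
adjudicated by that cell.

## References
* [GelbartRogawski1991] S. Gelbart, J. Rogawski, Invent. math. 105 (1991), §3.1 p. 454, Prop. 3.1.1.
* [Weil1964] A. Weil, Acta Math. 111 (1964), Chap. III n° 37–39 pp. 188–190.
* [Folland1989] G. B. Folland, *Harmonic Analysis in Phase Space*, Princeton UP 1989, §1.7, §4.2 Prop. (4.39).
* [MoeglinVignerasWaldspurger1987] C. Mœglin, M.-F. Vignéras, J.-L. Waldspurger, LNM 1291 (1987), Chap. 2 II.1–II.2.
-/

set_option autoImplicit false

noncomputable section

open scoped Matrix Real Classical ComplexConjugate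
open Complex NumberField NumberField.InfinitePlace NumberField.mixedEmbedding IsDedekindDomain
open Literature.NumberTheory.Automorphic Literature.NumberTheory.Automorphic.UnitaryGroup
open Literature.RepresentationTheory.HeisenbergGroup Literature.Analysis.SegalBargmann
open Literature.RepresentationTheory.KonnoKonno2007 Literature.RepresentationTheory.KonnoKonno2007.RealDualPair

namespace Literature.NumberTheory.Weil1964

open MpS UnitaryWeil

local notation "PV" σ => (σ → ℝ) × (σ → ℝ)
local notation "SpR" σ => symplecticGroup (polar (dotPairing σ))

section Lift

variable {F : Type} [Field F] [NumberField F] (E : Type) [Field E] [NumberField E] [Algebra F E]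
  [Algebra.IsQuadraticExtension F E] (c : E ≃ₐ[F] E) (N : ℕ) (hc : c ≠ 1) (hcc : c * c = 1)
  (p : {v : InfinitePlace F // v.IsReal} → Prop)
  (wOf₁ : {v : {v : InfinitePlace F // v.IsReal} // p v} → {w : InfinitePlace E // w.IsComplex})
  (hw₁ : ∀ k, c • (wOf₁ k).1 = (wOf₁ k).1) (hover₁ : ∀ k, (wOf₁ k).1.comap (algebraMap F E) = k.1.1)
  (wOf₂ : {v : {v : InfinitePlace F // v.IsReal} // ¬ p v} → {w : InfinitePlace E // w.IsReal})
  (hover₂ : ∀ k, (wOf₂ k).1.comap (algebraMap F E) = k.1.1)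
  (wOf : {v : InfinitePlace F // v.IsComplex} → {w : InfinitePlace E // w.IsComplex})
  (hover : ∀ v, (wOf v).1.comap (algebraMap F E) = v.1)
  (t₀ : Fin N → F) (ht0 : ∀ j, t₀ j ≠ 0) {T : Matrix (Fin N) (Fin N) F} (hTd : T = Matrix.diagonal t₀)
  {J : Matrix (Fin N) (Fin N) E} (hJ : J = T.map (algebraMap F E)) {δ : E} (hcδ : c δ = -δ) (hδ : δ ≠ 0)
  {d : F} (hd : δ * δ = algebraMap F E d)
  (x₂ : MpS (Fin N × {v : {v : InfinitePlace F // v.IsReal} // ¬ p v}))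
  (hx₂ : MpS.proj x₂ = placeSp fun k => (rsCayley3 E N p wOf₂ t₀ ht0 hδ k)⁻¹)
  (x₃ : MpS ((Fin N ⊕ Fin N) × {v : InfinitePlace F // v.IsComplex}))
  (hx₃ : MpS.proj x₃ = placeSp fun v => (cxKappaFamily F E N T (isSymm_of_diagonal N t₀ hTd)
    (isUnit_det_of_diagonal N t₀ ht0 hTd) hδ wOf v)⁻¹)
  (hTu : IsUnit (archMat F (Fin N) (T.map (algebraMap F (AdeleRing (𝓞 F) F)))))

/-- **`archWeilHalf3 x₂ hx₂ x₃ hx₃ : U(J)(F ⊗ ℝ) →* Mp_ψ(W_𝔸)ᶜᵒⁿᵗ`**, `g ↦ (ι_𝔸(g, 1), (e^* s(g) e_*) ⊗ 1)` — the archimedean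
half of the metaplectic splitting of `U(J)(𝔸_F)` for an arbitrary quadratic extension `E/F` of number fields.
[cite: GelbartRogawski1991, §3.1 p. 454, Prop. 3.1.1; Weil1964, Chap. III n° 37–39] -/
def archWeilHalf3 : UnitaryGroup.arch F E c N J →* adelicMpCont F (Fin N) (T.map (algebraMap F (AdeleRing (𝓞 F) F))) :=
  archLift (T.map (algebraMap F (AdeleRing (𝓞 F) F))) (frame3 E c N hc p wOf₁ hw₁ wOf hover t₀ ht0 hcδ hδ) hTu
    ((adelicToSymplectic F E c N hcδ hδ hd (isSymm_of_diagonal N t₀ hTd) hJ).comp (UnitaryGroup.archToAdelic F E c N J))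
    (archWeilSection3 E c N hc hcc p wOf₁ hw₁ hover₁ wOf₂ wOf t₀ ht0 hTd hJ hcδ hδ x₂ x₃)
    (adelicToSymplectic_comp_archToAdelic_finVec E c N hJ hcδ hδ hd (isSymm_of_diagonal N t₀ hTd))
    (archPhaseMap_eq_coe_proj_archWeilSection3 E c N hc hcc p wOf₁ hw₁ hover₁ wOf₂ hover₂ wOf hover t₀ ht0 hTd hJ hcδ hδ hd
      x₂ hx₂ x₃ hx₃ hTu)

/-- **`proj (s_∞ g) = ι_𝔸(g, 1)`** (field `proj_eq`). [cite: GelbartRogawski1991, §3.1 p. 454] -/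
@[simp] theorem proj_archWeilHalf3 (g : UnitaryGroup.arch F E c N J) :
    adelicMpCont.proj F (Fin N) _
        (archWeilHalf3 E c N hc hcc p wOf₁ hw₁ hover₁ wOf₂ hover₂ wOf hover t₀ ht0 hTd hJ hcδ hδ hd x₂ hx₂ x₃ hx₃ hTu g) =
      adelicToSymplectic F E c N hcδ hδ hd (isSymm_of_diagonal N t₀ hTd) hJ (UnitaryGroup.archToAdelic F E c N J g) := rfl

/-- **`ω(s_∞ g) = A_g ⊗ 1` is archimedean** (field `isArch`). [cite: Weil1964, Chap. III n° 38 p. 189] -/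
theorem isArch_archWeilHalf3 (g : UnitaryGroup.arch F E c N J) :
    ∃ A : SchwartzMap (Fin N → mixedSpace F) ℂ →L[ℂ] SchwartzMap (Fin N → mixedSpace F) ℂ,
      (adelicMpCont.omega F (Fin N) _
          (archWeilHalf3 E c N hc hcc p wOf₁ hw₁ hover₁ wOf₂ hover₂ wOf hover t₀ ht0 hTd hJ hcδ hδ hd x₂ hx₂ x₃ hx₃ hTu g) :
          piSchwartzBruhat F (Fin N) →ₗ[ℂ] piSchwartzBruhat F (Fin N)) =
        adelicTensorEnd (A : SchwartzMap (Fin N → mixedSpace F) ℂ →ₗ[ℂ] SchwartzMap (Fin N → mixedSpace F) ℂ) LinearMap.id :=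
  isArch_archLift _ _ _ _ _ _ _ g

/-- the archimedean operator explicitly: `e^* ∘ (archWeilSection3 x₂ x₃ g) ∘ e_*`. [cite: Weil1964, Chap. III n° 38 p. 189] -/
theorem omega_archWeilHalf3 (g : UnitaryGroup.arch F E c N J) :
    (adelicMpCont.omega F (Fin N) _
        (archWeilHalf3 E c N hc hcc p wOf₁ hw₁ hover₁ wOf₂ hover₂ wOf hover t₀ ht0 hTd hJ hcδ hδ hd x₂ hx₂ x₃ hx₃ hTu g) :
        piSchwartzBruhat F (Fin N) →ₗ[ℂ] piSchwartzBruhat F (Fin N)) =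
      adelicTensorEnd ((carrierConjEquiv (frame3 E c N hc p wOf₁ hw₁ wOf hover t₀ ht0 hcδ hδ)
          (archWeilSection3 E c N hc hcc p wOf₁ hw₁ hover₁ wOf₂ wOf t₀ ht0 hTd hJ hcδ hδ x₂ x₃ g).1.2 :
          SchwartzMap (Fin N → mixedSpace F) ℂ →L[ℂ] SchwartzMap (Fin N → mixedSpace F) ℂ) :
        SchwartzMap (Fin N → mixedSpace F) ℂ →ₗ[ℂ] SchwartzMap (Fin N → mixedSpace F) ℂ) LinearMap.id :=
  rfl

/-- **`s_∞` is continuous** (field `continuous`): the `π`-orbit maps of `ι_𝔸` and the `𝓢`-orbit maps of the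
three-block section are. [cite: Weil1964, Chap. III n° 39 p. 189; Folland1989, §1.7] -/
theorem continuous_archWeilHalf3 :
    Continuous (archWeilHalf3 E c N hc hcc p wOf₁ hw₁ hover₁ wOf₂ hover₂ wOf hover t₀ ht0 hTd hJ hcδ hδ hd x₂ hx₂ x₃ hx₃ hTu) :=
  continuous_archLift _ _ _ _ _ _ _
    (fun w => (continuous_adelicToSymplectic_apply F E c (N := N) hcδ hδ hd (isSymm_of_diagonal N t₀ hTd) hJ w).comp
      (UnitaryGroup.continuous_archToAdelic F E c N J))
    (continuous_archWeilSection3_apply E c N hc hcc p wOf₁ hw₁ hover₁ wOf₂ wOf t₀ ht0 hTd hJ hcδ hδ x₂ x₃)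

omit [NumberField E] [Algebra.IsQuadraticExtension F E] in
/-- **lifts `x₂`, `x₃` of the Cayley families exist** (Folland's `π : Mp^𝓢 → Sp` is onto), hence so does `s_∞`.
[cite: Folland1989, §4.2 Prop. (4.39)] -/
theorem exists_archWeilHalf3_lifts :
    (∃ x₂ : MpS (Fin N × {v : {v : InfinitePlace F // v.IsReal} // ¬ p v}),
        MpS.proj x₂ = placeSp fun k => (rsCayley3 E N p wOf₂ t₀ ht0 hδ k)⁻¹) ∧
      ∃ x₃ : MpS ((Fin N ⊕ Fin N) × {v : InfinitePlace F // v.IsComplex}),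
        MpS.proj x₃ = placeSp fun v => (cxKappaFamily F E N T (isSymm_of_diagonal N t₀ hTd)
          (isUnit_det_of_diagonal N t₀ ht0 hTd) hδ wOf v)⁻¹ :=
  ⟨MpS.proj_surjective _, exists_cxPlacesSection_lift F E N T _ _ hδ wOf⟩

end Lift

end Literature.NumberTheory.Weil1964

end
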